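import Mathlib.Analysis.SpecialFunctions.Pow.Real
import Mathlib.LinearAlgebra.Matrix.GeneralLinearGroup.Defs
import Mathlib.Data.ZMod.Basic
import Literature.RepresentationTheory.FiniteGroups.CharacterDegrees
import HarnessLib

/-!
# Green's degree bound for `GL_n(𝔽_p)`

Topic `Literature/RepresentationTheory/FiniteGroups`.  A NAMED FACT (statement only): every irreducible complex
character of `GL_n(𝔽_p)` has degree at most `2^n · p^{n(n-1)/2}`.

## Source and derivation

J. A. Green (1955) determined all irreducible characters of `G_n = GL_n(𝔽_q)` and their degrees; in the exposition
of Macdonald, *Symmetric Functions and Hall Polynomials* (2nd ed., 1995), Ch. IV §6, the irreducible characters are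
the `χ^λ` indexed by partition-valued functions `λ : Θ → 𝒫` with `‖λ‖ = Σ_φ d(φ)|λ(φ)| = n` ((6.8)), and their
degrees are ((6.7))

  `d_λ = ψ_n(q) ∏_{φ ∈ Θ} q_φ^{n(λ(φ)')} H̃_{λ(φ)}(q_φ)^{-1}`,  `ψ_n(q) = ∏_{i=1}^{n} (q^i - 1)`,
  `q_φ = q^{d(φ)}`,  `H̃_μ(t) = ∏_{x ∈ μ} (t^{h(x)} - 1)`  (hook lengths `h(x)`).

The bound recorded here is the immediate estimate of (6.7): `t^h - 1 ≥ t^h / 2` for `t ≥ 2`, `h ≥ 1`, and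
`Σ_{x ∈ μ} h(x) = |μ| + n(μ) + n(μ')` (Macdonald Ch. I §1 Ex. 2) give
`q_φ^{n(μ')} H̃_μ(q_φ)^{-1} ≤ 2^{|μ|} q_φ^{-|μ| - n(μ)} ≤ 2^{|μ|} q^{-d(φ)|μ|}`, hence
`d_λ ≤ 2^{Σ_φ |λ(φ)|} q^{-‖λ‖} ψ_n(q) ≤ 2^n q^{-n} ψ_n(q) < 2^n q^{n(n+1)/2 - n} = 2^n q^{n(n-1)/2}`.

We state it for prime fields `𝔽_p = ZMod p` (the case used by the matrix-multiplication programme).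
-- TODO(general form): `GL_n(𝔽_q)` for prime powers `q`, and the exact degree formula (6.7) itself (this needs the
-- parametrisation of `Irr(GL_n(𝔽_q))` by partition-valued functions on Frobenius orbits, not in the tree).

## What is NOT here
No proof (Green's theory: Deligne–Lusztig / Hall-algebra machinery is far from Mathlib); users take
`(h : GreenGLnDegreeBound)` as a hypothesis (conditional results), cf. CONVENTIONS §4.
-/

noncomputable section

namespace Literature.RepresentationTheory.FiniteGroups

/-- **Green's degree bound for `GL_n(𝔽_p)`** (statement only): for every prime `p`, every `n` and every
irreducible complex character `χ` of `GL_n(𝔽_p)`, `χ(1) ≤ 2^n · p^{n(n-1)/2}`.  Immediate from Green's degree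
formula `d_λ = ψ_n(q) ∏_φ q_φ^{n(λ(φ)')} H̃_{λ(φ)}(q_φ)^{-1}` (Green 1955; Macdonald 1995, Ch. IV §6 (6.7)–(6.8))
via `t^h - 1 ≥ t^h/2` and `Σ_{x∈μ} h(x) = |μ| + n(μ) + n(μ')`, which give `d_λ ≤ 2^n q^{-n} ψ_n(q) < 2^n q^{n(n-1)/2}`
(see the module docstring).  The true order of the largest degree is `q^{n(n-1)/2}(1 + O(1/q))`; the factor `2^n` is
slack.  [cite: Macdonald1995, Ch. IV §6 (6.7)-(6.8)] -/
def GreenGLnDegreeBound : Prop :=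
  ∀ (n p : ℕ) [Fact p.Prime], ∀ χ ∈ irrChars (Matrix.GeneralLinearGroup (Fin n) (ZMod p)),
    (χ 1).re ≤ 2 ^ n * (p : ℝ) ^ ((n : ℝ) * (n - 1) / 2)

end Literature.RepresentationTheory.FiniteGroups

end
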